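import Literature.NumberTheory.LFunctions.WeilExplicitContinuous
import Literature.NumberTheory.LFunctions.ZetaZeroReciprocalSum
import HarnessLib

/-!
# The test function `g_z(y) = e^{−(z−½)|y|}(log x − |y|)₊` in the Guinand–Weil explicit formula

Topic `Literature/NumberTheory/LFunctions`. Concrete objects (definitions with bodies, no named
facts) and PROVED identities for the derivation of Soundararajan's main lemma
(M. Balazard, A. de Roton, arXiv:0810.3587, Props. 3–5) from the tree's explicit formula for
continuous compactly supported test functions
(`Literature.NumberTheory.LFunctions.explicit_formula_continuous`): for `z ∈ ℂ` and `L = log x > 0`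
put `c = z − ½` and

  `g(y) = e^{−c|y|} (L − |y|)₊`  (`SoundTest.test c L`).

* `SoundTest.psiInt L a = ∫₀ᴸ (L−y) e^{ay} dy` and its closed form `(e^{aL} − 1 − aL)/a²`
  (`SoundTest.psiInt_eq`);
* `SoundTest.weilMellin_test` — `ĝ(s) = Ψ(s − ½ − c) + Ψ(−(s − ½) − c)`, i.e. `Ψ(s−z) + Ψ(1−s−z)`;
* `SoundTest.weilPrimeTerm_test` — the prime side is `2 Σ_{n ≤ x} Λ(n) n^{−z} log(x/n)`
  (`n^{−z}` written as `exp(−z log n)`), the left side of BR's Prop. 3 (eq. (t55)).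

## References

* [BalazardDeRoton2008] M. Balazard, A. de Roton, arXiv:0810.3587, Props. 3–5. [cite: BalazardDeRoton2008, Prop. 3]
* K. Soundararajan, J. reine angew. Math. 631 (2009), Lemma 1.
-/

noncomputable section

open Complex Filter Set MeasureTheory Topology intervalIntegral
open scoped Real

namespace Literature.NumberTheory.LFunctions

namespace SoundTest

/-! ## `Ψ(a) = ∫₀ᴸ (L − y) e^{ay} dy` -/

/-- `Ψ_L(a) = ∫₀ᴸ (L − y) e^{ay} dy`. [cite: BalazardDeRoton2008, Prop. 3 (proof)] -/
def psiInt (L : ℝ) (a : ℂ) : ℂ := ∫ y in (0 : ℝ)..L, ((L - y : ℝ) : ℂ) * Complex.exp (a * y)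

/-- Closed form: `Ψ_L(a) = (e^{aL} − 1 − aL)/a²` for `a ≠ 0`. [folklore] -/
theorem psiInt_eq {L : ℝ} {a : ℂ} (ha : a ≠ 0) :
    psiInt L a = (Complex.exp (a * L) - 1 - a * L) / a ^ 2 := by
  unfold psiInt
  have hid : ∀ y : ℝ, HasDerivAt (fun y : ℝ ↦ (y : ℂ)) 1 y := fun y ↦ by
    simpa using (hasDerivAt_id (y : ℂ)).comp_ofReal
  -- `F(y) = ((L − y) a + 1) e^{ay}` has `F' = a² (L − y) e^{ay}`
  have hderiv : ∀ y : ℝ, HasDerivAt (fun y : ℝ ↦ (((L : ℂ) - y) * a + 1) * Complex.exp (a * y))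
      (a ^ 2 * (((L - y : ℝ) : ℂ) * Complex.exp (a * y))) y := by
    intro y
    have h1 : HasDerivAt (fun y : ℝ ↦ ((L : ℂ) - y) * a + 1) (-1 * a) y := by
      have := (((hid y).const_sub (L : ℂ)).mul_const a).add_const (1 : ℂ)
      simpa using this
    have h2 : HasDerivAt (fun y : ℝ ↦ Complex.exp (a * y)) (Complex.exp (a * y) * (a * 1)) y :=
      ((hid y).const_mul a).cexp
    refine (h1.mul h2).congr_deriv ?_
    push_cast
    ring
  have hcont : Continuous fun y : ℝ ↦ a ^ 2 * (((L - y : ℝ) : ℂ) * Complex.exp (a * y)) := by fun_prop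
  have hint := intervalIntegral.integral_eq_sub_of_hasDerivAt (fun y _ ↦ hderiv y) (hcont.intervalIntegrable 0 L)
  rw [intervalIntegral.integral_const_mul] at hint
  rw [eq_div_iff (pow_ne_zero 2 ha), mul_comm, hint]
  simp only [Complex.ofReal_zero, mul_zero, Complex.exp_zero, mul_one, sub_zero]
  ring

/-- `Ψ_L(0) = L²/2`. [folklore] -/
theorem psiInt_zero (L : ℝ) : psiInt L 0 = ((L ^ 2 / 2 : ℝ) : ℂ) := by
  unfold psiInt
  simp only [zero_mul, Complex.exp_zero, mul_one]
  rw [intervalIntegral.integral_ofReal, intervalIntegral.integral_sub intervalIntegrable_const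
    intervalIntegral.intervalIntegrable_id, intervalIntegral.integral_const, integral_id]
  congr 1
  simp only [smul_eq_mul]
  ring

/-! ## The test function -/

/-- `g(y) = e^{−c|y|} (L − |y|)₊` (with `c = z − ½`, `L = log x`). [cite: BalazardDeRoton2008, Prop. 3 (proof)] -/
def test (c : ℂ) (L : ℝ) (y : ℝ) : ℂ :=
  Complex.exp (-(c * |y|)) * ((max (L - |y|) 0 : ℝ) : ℂ)

/-- `g` is continuous. [folklore] -/
theorem continuous_test (c : ℂ) (L : ℝ) : Continuous (test c L) := by
  unfold test
  fun_prop

/-- `g` vanishes off `[−L, L]`. [folklore] -/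
theorem test_eq_zero {c : ℂ} {L y : ℝ} (hy : L ≤ |y|) : test c L y = 0 := by
  simp [test, max_eq_right (by linarith : L - |y| ≤ 0)]

/-- `g` has compact support (in `[−L, L]`). [folklore] -/
theorem hasCompactSupport_test (c : ℂ) (L : ℝ) : HasCompactSupport (test c L) := by
  refine HasCompactSupport.intro (isCompact_Icc (a := -L) (b := L)) fun y hy ↦ test_eq_zero ?_
  rw [mem_Icc, not_and_or, not_le, not_le] at hy
  rcases hy with h | h
  · exact le_trans (by linarith) (neg_le_abs y)
  · exact le_trans h.le (le_abs_self y)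

/-- On `[0, L]`: `g(y) = e^{−cy}(L − y)` and `g(−y) = g(y)`. [folklore] -/
theorem test_of_nonneg {c : ℂ} {L y : ℝ} (hy : 0 ≤ y) (hyL : y ≤ L) :
    test c L y = Complex.exp (-(c * y)) * ((L - y : ℝ) : ℂ) := by
  simp [test, abs_of_nonneg hy, max_eq_left (by linarith : 0 ≤ L - y)]

/-- `g` is even. [folklore] -/
theorem test_neg (c : ℂ) (L y : ℝ) : test c L (-y) = test c L y := by simp [test]

/-! ## The Mellin–Laplace transform -/

/-- **`ĝ(s) = Ψ(s − ½ − c) + Ψ(−(s − ½) − c)`** (for `c = z − ½`: `Ψ(s − z) + Ψ(1 − s − z)`).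
[cite: BalazardDeRoton2008, Prop. 3 (proof)] -/
theorem weilMellin_test (c : ℂ) {L : ℝ} (hL : 0 ≤ L) (s : ℂ) :
    weilMellin (test c L) s = psiInt L (s - 1 / 2 - c) + psiInt L (-(s - 1 / 2) - c) := by
  unfold weilMellin
  -- restrict to `[−L, L]`
  have hzero : ∀ y : ℝ, y ∉ Set.Icc (-L) L → test c L y * Complex.exp ((s - 1 / 2) * y) = 0 := by
    intro y hy
    rw [mem_Icc, not_and_or, not_le, not_le] at hy
    have : L ≤ |y| := by
      rcases hy with h | h
      · exact le_trans (by linarith) (neg_le_abs y)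
      · exact h.le.trans (le_abs_self y)
    rw [test_eq_zero this, zero_mul]
  have hcont : Continuous fun y : ℝ ↦ test c L y * Complex.exp ((s - 1 / 2) * y) :=
    (continuous_test c L).mul (by fun_prop)
  rw [← setIntegral_eq_integral_of_forall_compl_eq_zero hzero, integral_Icc_eq_integral_Ioc,
    ← intervalIntegral.integral_of_le (by linarith : -L ≤ L),
    ← intervalIntegral.integral_add_adjacent_intervals (b := 0) (hcont.intervalIntegrable _ _)
      (hcont.intervalIntegrable _ _)]
  -- the piece on `[−L, 0]`: substitute `y ↦ −y`
  have hneg : ∫ y in (-L)..0, test c L y * Complex.exp ((s - 1 / 2) * y) =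
      ∫ y in (0 : ℝ)..L, test c L y * Complex.exp (-(s - 1 / 2) * y) := by
    rw [← neg_zero, ← intervalIntegral.integral_comp_neg (fun y ↦ test c L y * Complex.exp ((s - 1 / 2) * y))]
    simp only [neg_zero]
    refine intervalIntegral.integral_congr fun y _ ↦ ?_
    simp only [test_neg]
    congr 1; push_cast; ring_nf
  rw [hneg, add_comm]
  unfold psiInt
  congr 1
  · refine intervalIntegral.integral_congr fun y hy ↦ ?_
    rw [Set.uIcc_of_le hL, mem_Icc] at hy
    rw [test_of_nonneg hy.1 hy.2, mul_comm (Complex.exp _), mul_assoc, ← Complex.exp_add]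
    congr 2; ring
  · refine intervalIntegral.integral_congr fun y hy ↦ ?_
    rw [Set.uIcc_of_le hL, mem_Icc] at hy
    rw [test_of_nonneg hy.1 hy.2, mul_comm (Complex.exp _), mul_assoc, ← Complex.exp_add]
    congr 2; ring

/-! ## The prime side -/

/-- At `y = ± log n` (`1 ≤ n ≤ e^L`): `g(± log n) = e^{−c log n}(L − log n)`. [folklore] -/
theorem test_log {c : ℂ} {L : ℝ} {n : ℕ} (hn : 1 ≤ n) (hnL : (n : ℝ) ≤ Real.exp L) :
    test c L (Real.log n) = Complex.exp (-(c * Real.log n)) * ((L - Real.log n : ℝ) : ℂ) := by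
  have hlog0 : 0 ≤ Real.log n := Real.log_nonneg (by exact_mod_cast hn)
  have hlogL : Real.log n ≤ L := by
    rw [← Real.log_exp L]; exact Real.log_le_log (by exact_mod_cast Nat.lt_of_lt_of_le Nat.zero_lt_one hn) hnL
  exact test_of_nonneg hlog0 hlogL

/-- `g(log n) = 0` for `n > e^L`. [folklore] -/
theorem test_log_eq_zero {c : ℂ} {L : ℝ} {n : ℕ} (hnL : Real.exp L ≤ n) : test c L (Real.log n) = 0 := by
  refine test_eq_zero ?_
  have hn0 : (0 : ℝ) < n := (Real.exp_pos L).trans_le hnL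
  have : L ≤ Real.log n := by rw [← Real.log_exp L]; exact Real.log_le_log (Real.exp_pos L) hnL
  exact this.trans (le_abs_self _)

/-- **The prime side of the explicit formula for `g`** is the finite sum
`2 Σ_{1 ≤ n ≤ e^L} Λ(n) n^{−½} e^{−c log n} (L − log n)` ( `= 2 Σ_{n ≤ x} Λ(n) n^{−z} log(x/n)` with
`x = e^L`, `z = c + ½`). [cite: BalazardDeRoton2008, Prop. 3] -/
theorem weilPrimeTerm_test (c : ℂ) (L : ℝ) :
    weilPrimeTerm (test c L) =
      2 * ∑ n ∈ Finset.Icc 1 ⌊Real.exp L⌋₊, ((ArithmeticFunction.vonMangoldt n : ℝ) : ℂ) / (Real.sqrt n : ℂ) *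
        (Complex.exp (-(c * Real.log n)) * ((L - Real.log n : ℝ) : ℂ)) := by
  classical
  unfold weilPrimeTerm
  rw [tsum_eq_sum (s := Finset.Icc 1 ⌊Real.exp L⌋₊), Finset.mul_sum]
  · refine Finset.sum_congr rfl fun n hn ↦ ?_
    rw [Finset.mem_Icc] at hn
    have hnL : (n : ℝ) ≤ Real.exp L := (Nat.cast_le.2 hn.2).trans (Nat.floor_le (Real.exp_pos L).le)
    rw [test_neg, test_log hn.1 hnL]
    ring
  · intro n hn
    rw [Finset.mem_Icc, not_and_or, not_le, not_le] at hn
    rcases hn with h | h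
    · have : n = 0 := by omega
      subst this; simp
    · have hnL : Real.exp L ≤ n := by
        have := Nat.lt_floor_add_one (Real.exp L)
        exact this.le.trans (by exact_mod_cast h)
      rw [test_neg, test_log_eq_zero hnL]
      simp

end SoundTest

end Literature.NumberTheory.LFunctions
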